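import Mathlib
import Literature.Computability.AlgebraicComplexity.DepthThreeRankBound
import Summits.ValiantsHypothesis.ValiantsHypothesis.Theorems.MonotoneRestorationOrbitRestorationQPLevelStructureC
import Summits.ValiantsHypothesis.ValiantsHypothesis.Theorems.MonotoneRestorationOrbitRestorationQPGoodScale
import Summits.ValiantsHypothesis.ValiantsHypothesis.Theorems.MonotoneRestorationOrbitRestorationQPPiSigmaClass
import Summits.ValiantsHypothesis.ValiantsHypothesis.Theorems.MonotoneRestorationOrbitRestorationQPRestorable
import Summits.ValiantsHypothesis.ValiantsHypothesis.Theorems.MonotoneRestorationOrbitRestorationQPSigmaKThresholds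
import Summits.ValiantsHypothesis.ValiantsHypothesis.Theorems.MonotoneRestorationOrbitRestorationQPVsbr
import HarnessLib

/-!
# Stub A_k of line `depth-three-rung`: the `ΣΠΣ(k)` sub-rung in value currency from the `ΠΣ` sub-rung and the rank bound (ORBIT currency)

Route MonotoneRestoration, crux `OrbitRestorationQP` (stmt-ValiantsHypothesis-18293), line `depth-three-rung`, registered stub
`stub_sigmaPiSigmaKValue` (A_k), BY NAME AND SIGNATURE, in the namespace of the line's Theorems-side Defs
`Summit.ValiantsHypothesis.ValiantsHypothesis.Theorems.OrbitRestorationQPDepthThreeRung` (statements agree with the skeleton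
`Cruxes/OrbitRestorationQP/Lines/depth_three_rung.lean` by `δ`-unfolding).

Given the Saxena–Seshadhri rank bound `depthThree_rankBound` (named Literature fact, hypothesis) and the `ΠΣ` sub-rung A₁
(hypothesis: every matrix-symmetric `PDClass 1` family given as ONE scaled product of `≤ n^c + c` affine forms is quasi-polynomially
orbit-restorable), every matrix-symmetric `PDClass 1` family given at every level as a sum of `≤ k` scaled products of `≤ n^c + c`
affine forms is quasi-polynomially orbit-restorable.  Proof = Structure Theorem S of the crux workfile
`Lines/depth-three-rung-stubA-bounded-fanin.md` (§2–3), assembled from the layers `…ClusterMatching`, `…GoodScale` (p4), `…RankDistance`,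
`…HomogTools`, `…RankBoundBridge`, `…ProductAction`, `…LinearSubalgebra`, `…LinNL`, `…LevelRep`, `…LevelMatch`, `…LevelAction`,
`…LevelStructureA/B/C`, `…SigmaKThresholds`, `…PiSigmaClass`, `…Restorable`:

* `level_data` — at every level `n ≥ levelThreshold k c`, `f n = Σ_{j<k} u_j · Π Lin_j · Q_j(U)` with matrix-symmetric affine
  products `Π Lin_j` of `≤ n^c + c` factors and univariate `Q_j`, `U = Σ x_{pq}` (clean representation, good scale, `Setting`,
  `structure_level`, padding to `Fin k`);
* `stub_sigmaPiSigmaKValue` — the registered stub: the `k` families `n ↦ Π Lin_j(n)` (`1` below the threshold) are fed to A₁ (they lie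
  in `PDClass 1 n (4c+8)` by `…PiSigmaClass`), `Q_j(U)` and the finitely many small levels are restorable outright (`…Restorable`),
  and the closure rules of `…ValueOrbitClosure` assemble the level.

VP ≠ VNP is not touched: this is the bounded-top-fan-in sub-rung A_k ≡ A₁ + RB of the first rung of the product-depth ladder.
Everything is proved modulo the two hypotheses taken BY NAME (RB) resp. as the registered stub A₁ (an argument).
[cite: SaxenaSeshadhri2013, Theorem 5; KarninShpilka2009, §3; DawarWilsenach2025, §3.3]
-/

noncomputable section

open MvPolynomial Equiv Literature.Computability.AlgebraicComplexity

-- `Summit.ValiantsHypothesis.ValiantsHypothesis.…` is the tree's single-conjunct layout (Sub = Summit).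
set_option linter.dupNamespace false

namespace Summit.ValiantsHypothesis.ValiantsHypothesis.Theorems

namespace SigmaPiSigmaK

open RankDistance LevelRep LevelStructure SigmaKThresholds PiSigmaClass Restorable OrbitRestorationQPDepthThreeRung

variable {n : ℕ}

/-! ### A good labelling from a good scale -/

/-- The linkage relation at scale `θ`. [folklore] -/
def Linked {m : ℕ} (δ : Fin m → Fin m → ℕ) (θ : ℕ) (i j : Fin m) : Prop := Relation.ReflTransGen (fun a b => δ a b ≤ θ) i j

/-- The canonical representative of the linkage class of `i` (its least element). [folklore] -/
def rep {m : ℕ} (δ : Fin m → Fin m → ℕ) (θ : ℕ) (i : Fin m) : Fin m := by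
  classical
  exact (Finset.univ.filter fun j => Linked δ θ i j).min' ⟨i, by simp [Linked, Relation.ReflTransGen.refl]⟩

/-- Two indices have the same representative iff they are linked (for a symmetric `δ`). [folklore] -/
theorem rep_eq_rep_iff {m : ℕ} (δ : Fin m → Fin m → ℕ) (hs : ∀ i j, δ i j = δ j i) (θ : ℕ) (i j : Fin m) :
    rep δ θ i = rep δ θ j ↔ Linked δ θ i j := by
  classical
  have hsymm : ∀ a b, Linked δ θ a b → Linked δ θ b a := fun a b h => RankClustering.linked_symm δ hs h
  have htrans : ∀ a b d, Linked δ θ a b → Linked δ θ b d → Linked δ θ a d := fun a b d h1 h2 => h1.trans h2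
  have hmem : ∀ a, Linked δ θ a (rep δ θ a) := by
    intro a
    have := Finset.min'_mem (Finset.univ.filter fun j => Linked δ θ a j) ⟨a, by simp [Linked, Relation.ReflTransGen.refl]⟩
    exact (Finset.mem_filter.1 this).2
  constructor
  · intro h
    exact htrans _ _ _ (hmem i) (h ▸ hsymm _ _ (hmem j))
  · intro h
    unfold rep
    congr 1
    ext l
    simp only [Finset.mem_filter, Finset.mem_univ, true_and]
    exact ⟨fun hl => htrans _ _ _ (hsymm _ _ h) hl, fun hl => htrans _ _ _ h hl⟩

/-! ### The structure data at a big level -/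

/-- **THE STRUCTURE DATA AT A BIG LEVEL.**  For `n ≥ levelThreshold k c`, a matrix-symmetric `f` given as a sum of `k` scaled products
of `≤ n^c + c` affine forms is `Σ_{j<k} u_j · Π Lin_j · Q_j(U)` with matrix-symmetric products `Π Lin_j` of `≤ n^c + c` polynomials of
degree `≤ 1` and univariate `Q_j`.  Granting the rank bound. [cite: KarninShpilka2009, §3; SaxenaSeshadhri2013, Theorem 5] -/
theorem level_data (hRB : depthThree_rankBound) (k c n : ℕ) (hn : levelThreshold k c ≤ n) (f : MvPolynomial (Fin n × Fin n) ℂ)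
    (hsym : ∀ σ τ : Perm (Fin n), rename (fun p : Fin n × Fin n => (σ p.1, τ p.2)) f = f)
    (a : Fin k → ℂ) (L : Fin k → Multiset (MvPolynomial (Fin n × Fin n) ℂ)) (hL : ∀ i, ∀ q ∈ L i, q.totalDegree ≤ 1)
    (hcard : ∀ i, Multiset.card (L i) ≤ n ^ c + c) (hf : f = ∑ i, C (a i) * (L i).prod) :
    ∃ (u : Fin k → ℂ) (Lin : Fin k → Multiset (MvPolynomial (Fin n × Fin n) ℂ)) (Q : Fin k → Polynomial ℂ),
      (∀ j, ∀ q ∈ Lin j, q.totalDegree ≤ 1) ∧ (∀ j, Multiset.card (Lin j) ≤ n ^ c + c) ∧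
      (∀ j (σ τ : Perm (Fin n)), rename (fun p : Fin n × Fin n => (σ p.1, τ p.2)) (Lin j).prod = (Lin j).prod) ∧
      f = ∑ j, C (u j) * (Lin j).prod * Polynomial.aeval (U n) (Q j) := by
  classical
  obtain ⟨h8, hkn, hc2, hc3, hchoose, hdim⟩ := conditions_of_le hn
  set D := n ^ c + c with hD
  -- clean representation
  obtain ⟨R, hRm⟩ := exists_cleanRep (D := D) a L hL hcard hf
  -- good scale
  set δ : Fin R.m → Fin R.m → ℕ := fun i j => rdist (R.L i) (R.L j) with hδ
  have hδs : ∀ i j, δ i j = δ j i := fun i j => rdist_comm _ _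
  have hδt : ∀ i j l, δ i l ≤ δ i j + δ j l := fun i j l => rdist_triangle _ _ _
  have hδ0 : ∀ i, δ i i = 0 := fun i => rdist_self _
  obtain ⟨m₀, hm₀, hgood⟩ := RankClustering.exists_good_scale δ (Rb R.m D)
  rw [Fintype.card_fin] at hm₀ hgood
  set θ := (2 * R.m + 2) ^ m₀ * (Rb R.m D + 1) with hθ
  set Θ := (R.m - 1) * θ with hΘ
  let cl : Fin R.m → Fin R.m := rep δ θ
  have hdiam : ∀ i j, cl i = cl j → rdist (R.L i) (R.L j) ≤ Θ := by
    intro i j hij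
    have := RankClustering.dist_le_of_linked δ hδt hδ0 ((rep_eq_rep_iff δ hδs θ i j).1 hij)
    rwa [Fintype.card_fin] at this
  have hsep : ∀ i j, cl i ≠ cl j → 2 * Rb R.m D + Θ < rdist (R.L i) (R.L j) := by
    intro i j hij
    by_contra hle
    refine hij ((rep_eq_rep_iff δ hδs θ i j).2 (hgood i j ?_))
    show rdist (R.L i) (R.L j) ≤ _
    rw [hΘ] at hle
    push Not at hle
    nlinarith
  -- the setting and its side conditions
  let S : Setting n D :=
    { f := f, hsym := fun σ τ => by rw [mact_apply]; exact hsym σ τ, R := R, cl := cl, Θ := Θ, hdiam := hdiam, hsep := hsep,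
      hn8 := h8, hmn := lt_of_le_of_lt hRm hkn }
  have hHyps : S.Hyps c := by
    refine ⟨lt_of_le_of_lt (Nat.mul_le_mul_right _ hRm) hchoose, hc2, hc3, le_trans ?_ hdim⟩
    -- the dimension expression is dominated by `dimBound k c n`
    show 4 * (R.m * (1 + R.m ^ 2 * Θ)) + 8 ≤ dimBound k c n
    unfold dimBound
    have hθle : θ ≤ (2 * k + 2) ^ (k ^ 2) * (rbBound k c n + 1) := by
      rw [hθ]
      refine Nat.mul_le_mul ?_ (Nat.add_le_add_right (rb_le_rbBound hRm c n) 1)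
      calc (2 * R.m + 2) ^ m₀ ≤ (2 * k + 2) ^ m₀ := Nat.pow_le_pow_left (by omega) _
        _ ≤ (2 * k + 2) ^ (k ^ 2) := Nat.pow_le_pow_right (by omega) (hm₀.trans (Nat.pow_le_pow_left hRm 2))
    have hΘle : Θ ≤ (k - 1) * ((2 * k + 2) ^ (k ^ 2) * (rbBound k c n + 1)) :=
      Nat.mul_le_mul (Nat.sub_le_sub_right hRm 1) hθle
    gcongr
  -- the structure theorem at this level
  obtain ⟨u, Lin, Q, h1, h2, h3, h4⟩ := S.structure_level hRB hHyps
  -- pad to `Fin k`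
  refine ⟨fun j => if h : (j : ℕ) < R.m then u ⟨j, h⟩ else 0, fun j => if h : (j : ℕ) < R.m then Lin ⟨j, h⟩ else 0,
    fun j => if h : (j : ℕ) < R.m then Q ⟨j, h⟩ else 0, fun j q hq => ?_, fun j => ?_, fun j σ τ => ?_, ?_⟩
  · dsimp only at hq
    by_cases h : (j : ℕ) < R.m
    · rw [dif_pos h] at hq; exact (h1 _ q hq).le
    · rw [dif_neg h] at hq; exact absurd hq (Multiset.notMem_zero q)
  · dsimp only
    by_cases h : (j : ℕ) < R.m
    · rw [dif_pos h]; exact h2 _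
    · rw [dif_neg h]; simp
  · dsimp only
    by_cases h : (j : ℕ) < R.m
    · rw [dif_pos h, ← mact_apply]; exact h3 _ σ τ
    · rw [dif_neg h]; simp
  · -- the padded sum is the sum over `Fin R.m`
    have hval : ∀ i : Fin R.m, ((Fin.castLEEmb hRm i : Fin k) : ℕ) = i := fun i => rfl
    have hf4 : f = ∑ i : Fin R.m, C (u i) * (Lin i).prod * Polynomial.aeval (U n) (Q i) := h4
    refine hf4.trans ?_
    symm
    rw [← Finset.sum_subset (Finset.subset_univ (Finset.univ.map (Fin.castLEEmb hRm))), Finset.sum_map]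
    · refine Finset.sum_congr rfl fun i _ => ?_
      have h : ((Fin.castLEEmb hRm i : Fin k) : ℕ) < R.m := by rw [hval]; exact i.isLt
      have he : (⟨((Fin.castLEEmb hRm i : Fin k) : ℕ), h⟩ : Fin R.m) = i := Fin.ext (hval i)
      simp only [dif_pos h, he]
    · intro j _ hj
      have h : ¬ (j : ℕ) < R.m := fun h => hj (Finset.mem_map.2 ⟨⟨j, h⟩, Finset.mem_univ _, Fin.ext rfl⟩)
      simp only [dif_neg h, C_0, zero_mul]

/-! ### The stub -/

/-- Diagonal invariance from matrix symmetry. [folklore] -/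
theorem ren_eq_of_matrixSymmetric {f : (n : ℕ) → MvPolynomial (Fin n × Fin n) ℂ} (hsym : IsMatrixSymmetric f) (n : ℕ)
    (σ : Perm (Fin n)) : ren σ (f n) = f n := by
  rw [ren_eq_mact, mact_apply]; exact hsym n σ σ

end SigmaPiSigmaK

namespace OrbitRestorationQPDepthThreeRung

open SigmaPiSigmaK SigmaKThresholds PiSigmaClass Restorable LevelStructure

/-- **Stub `stub_sigmaPiSigmaKValue` of line `depth-three-rung` (A_k), by name and signature — THE `ΣΠΣ(k)` SUB-RUNG IN VALUE
CURRENCY FROM A₁ AND THE RANK BOUND.**  Given the Saxena–Seshadhri rank bound for simple minimal `ΣΠΣ(k,d)` identities (the named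
Literature fact `depthThree_rankBound`, hypothesis) and the `ΠΣ` sub-rung A₁ (hypothesis), every matrix-symmetric `PDClass 1` family
given at every level as a sum of at most `k` scaled products of at most `n^c + c` affine forms is quasi-polynomially orbit-restorable:
at large levels the Structure Theorem writes `f n = Σ_j u_j · Π Lin_j · Q_j(U)` with matrix-symmetric affine products (fed to A₁ as
`k` families) and univariate `Q_j` in the invariant form `U`; small levels cost one constant.
[cite: SaxenaSeshadhri2013, Theorem 5; KarninShpilka2009, §3; DawarWilsenach2025, §3.3] -/
theorem stub_sigmaPiSigmaKValue (k : ℕ) :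
    Literature.Computability.AlgebraicComplexity.depthThree_rankBound →
    (∀ f : (n : ℕ) → MvPolynomial (Fin n × Fin n) ℂ, IsMatrixSymmetric f →
      (∃ c : ℕ, ∀ n : ℕ, PDClass (fun _ => 1) n c (f n) ∧
        ∃ (a : ℂ) (L : Multiset (MvPolynomial (Fin n × Fin n) ℂ)),
          (∀ ℓ ∈ L, ℓ.totalDegree ≤ 1) ∧ Multiset.card L ≤ n ^ c + c ∧ f n = MvPolynomial.C a * L.prod) →
      ∃ c : ℕ, ∀ n : ℕ, QPOrbitRestorable c n (f n)) →
    ∀ f : (n : ℕ) → MvPolynomial (Fin n × Fin n) ℂ, IsMatrixSymmetric f →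
      (∃ c : ℕ, ∀ n : ℕ, PDClass (fun _ => 1) n c (f n) ∧
        ∃ (a : Fin k → ℂ) (L : Fin k → Multiset (MvPolynomial (Fin n × Fin n) ℂ)),
          (∀ i, ∀ ℓ ∈ L i, ℓ.totalDegree ≤ 1) ∧ (∀ i, Multiset.card (L i) ≤ n ^ c + c) ∧
          f n = ∑ i, MvPolynomial.C (a i) * (L i).prod) →
      ∃ c : ℕ, ∀ n : ℕ, QPOrbitRestorable c n (f n) := by
  intro hRB hA1 f hsym hf
  classical
  obtain ⟨c, hc⟩ := hf
  set N₀ := levelThreshold k c with hN₀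
  -- the structure data at the big levels
  have hdata : ∀ n, N₀ ≤ n → ∃ (u : Fin k → ℂ) (Lin : Fin k → Multiset (MvPolynomial (Fin n × Fin n) ℂ)) (Q : Fin k → Polynomial ℂ),
      (∀ j, ∀ q ∈ Lin j, q.totalDegree ≤ 1) ∧ (∀ j, Multiset.card (Lin j) ≤ n ^ c + c) ∧
      (∀ j (σ τ : Perm (Fin n)), rename (fun p : Fin n × Fin n => (σ p.1, τ p.2)) (Lin j).prod = (Lin j).prod) ∧
      f n = ∑ j, C (u j) * (Lin j).prod * Polynomial.aeval (U n) (Q j) := by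
    intro n hn
    obtain ⟨-, a, L, hL, hcard, hfn⟩ := hc n
    exact level_data hRB k c n hn (f n) (hsym n) a L hL hcard hfn
  choose u Lin Q hLin1 hLin2 hLin3 hfsum using hdata
  -- the `k` matrix-symmetric affine-product families
  let g : Fin k → (n : ℕ) → MvPolynomial (Fin n × Fin n) ℂ := fun j n => if hn : N₀ ≤ n then (Lin n hn j).prod else 1
  have hg_big : ∀ j n (hn : N₀ ≤ n), g j n = (Lin n hn j).prod := fun j n hn => by simp only [g, dif_pos hn]
  have hg_small : ∀ j n, ¬ N₀ ≤ n → g j n = 1 := fun j n hn => by simp only [g, dif_neg hn]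
  have hg_sym : ∀ j, IsMatrixSymmetric (g j) := by
    intro j n σ τ
    by_cases hn : N₀ ≤ n
    · rw [hg_big j n hn]; exact hLin3 n hn j σ τ
    · rw [hg_small j n hn, map_one]
  have hg_hyp : ∀ j, ∃ c₁ : ℕ, ∀ n : ℕ, PDClass (fun _ => 1) n c₁ (g j n) ∧
      ∃ (a : ℂ) (L : Multiset (MvPolynomial (Fin n × Fin n) ℂ)),
        (∀ ℓ ∈ L, ℓ.totalDegree ≤ 1) ∧ Multiset.card L ≤ n ^ c₁ + c₁ ∧ g j n = MvPolynomial.C a * L.prod := by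
    intro j
    refine ⟨4 * c + 8, fun n => ?_⟩
    by_cases hn : N₀ ≤ n
    · rw [hg_big j n hn]
      refine ⟨pdClass_one_affineProd _ (hLin1 n hn j) (hLin2 n hn j), 1, Lin n hn j, hLin1 n hn j,
        (hLin2 n hn j).trans (vsbr_pbound_mono (by omega) n), by rw [C_1, one_mul]⟩
    · rw [hg_small j n hn]
      refine ⟨?_, 1, 0, by simp, by simp, by simp⟩
      have := pdClass_one_affineProd (n := n) (c := c) (0 : Multiset (MvPolynomial (Fin n × Fin n) ℂ)) (by simp) (by simp)
      simpa using this
  have hA : ∀ j, ∃ cj : ℕ, ∀ n, QPOrbitRestorable cj n (g j n) := fun j => hA1 (g j) (hg_sym j) (hg_hyp j)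
  choose cg hcg using hA
  set cA : ℕ := max (Finset.univ.sup cg) 5 with hcA
  have hcg_le : ∀ j, cg j ≤ cA := fun j => (Finset.le_sup (f := cg) (Finset.mem_univ j)).trans (le_max_left _ _)
  -- big levels
  have hbig : ∀ n, N₀ ≤ n → QPOrbitRestorable (cA + 6 + 3 * k) n (f n) := by
    intro n hn
    rw [hfsum n hn]
    refine qpOrbitRestorable_sum (c := cA + 6) (by omega) k
      (fun j => C (u n hn j) * (Lin n hn j).prod * Polynomial.aeval (U n) (Q n hn j)) fun j => ?_
    have h1 : QPOrbitRestorable cA n (g j n) := qpOrbitRestorable_mono (hcg_le j) (hcg j n)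
    have h2 : QPOrbitRestorable cA n (Polynomial.aeval (U n) (Q n hn j)) :=
      qpOrbitRestorable_mono (le_max_right _ _) (qpOrbitRestorable_aeval_U _)
    have h3 := ValueOrbit.qpOrbitRestorable_smul (u n hn j) (ValueOrbit.qpOrbitRestorable_mul h1 h2)
    rw [hg_big j n hn, ← mul_assoc] at h3
    exact qpOrbitRestorable_mono (by omega) h3
  -- small levels
  have hsmall : ∀ n, n < N₀ → QPOrbitRestorable (N₀.factorial + 5) n (f n) := fun n hn =>
    qpOrbitRestorable_mono (Nat.add_le_add_right (Nat.factorial_le hn.le) 5)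
      (qpOrbitRestorable_of_invariant (f n) (ren_eq_of_matrixSymmetric hsym n))
  refine ⟨max (cA + 6 + 3 * k) (N₀.factorial + 5), fun n => ?_⟩
  by_cases hn : N₀ ≤ n
  · exact qpOrbitRestorable_mono (le_max_left _ _) (hbig n hn)
  · exact qpOrbitRestorable_mono (le_max_right _ _) (hsmall n (not_le.1 hn))

end OrbitRestorationQPDepthThreeRung


end Summit.ValiantsHypothesis.ValiantsHypothesis.Theorems

end
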